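import Summits.QuantumFields.YangMills.Theorems.BalabanUVNodesN15CurvedGluingCubeDressedGeneralRows
import HarnessLib

/-!
# Route «BalabanUVNodes» (cluster K4 «SpineRates»), Track-A DAG node N15 = NE2, BACKGROUND LAYER — LEFT FACTORS THROUGH THE DRESSING: `T∘X = (T∘G₀)∘(1 + V̂X̂)` for an ARBITRARY left factor
# `T` of the general dressed cube, its letter, two-sided localization and η-defect (FILE 55's ENTRY-3 family `hG3`∕`hK3′`∕`hIG3`∕`hDK3` — second-order `D₃` — and any left `D` outside the jet)

Cell `pub-ymgap`, seat `pub-ymgap-dag-n15-w3` (WIDTH SEAT 3∕3 on node N15, director-ym №197 ∕ HUMAN RULING D-0149; plan `W-SEAT-START-LIST.md` §n15 item 3 «LG-vector + background layers at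
GENERAL small-field U» — thirtieth piece).  `bears_on: R4∕N15 · K3⁷ SpineGivenEndpointR13SepCoPH (stmt-QuantumFields-20544)`.  Filed `--kind proof --supports stmt-QuantumFields-20544 --as helper` —
COUNT-NEUTRAL.  Theorems only; 0 `sorry`.  Imports BY NAME file 25 `…N15CurvedGluingCubeDressedGeneralRows` (through it file 23 `projO_none_dressedV`, `hasMaj_dressedV_pair`, `dressedV_comp_eq_self`,
file 24 `hasMaj_V_bgPropVE`, `idef_out_in`, file 21 `mulOp_eq_zero_of_vanish`; dag-n15-c B1a `bgPropV`, B2 `stack`∕`projO`∕`hasMaj_stack`, FILE 47 `hasMaj_localize`, FILE 45 `hasMaj_comp_diag`∕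
`hasMaj_diag_comp`; lit `idef`∕`idef_comp`∕`idef_add`, `hasMaj_comp_exp`); nothing in the tree is modified.

WHY.  FILE 55 `gluedLetters_of_cubeRows` reads every cube through FOUR entries — `G_□` (`β`), `D∘G_□` (`β₁`), `G_□∘E` (`β₂`), `D₃∘G_□` (`β₃`, the SECOND-ORDER left factor of FILE 54) — the
commutator row `[D₃, M_{h_□}]∘G_□` (`θ₃`) and all their two-grid defects.  For the general dressed cube `X = pr₀X̂`, `X̂ = (1 − ŜV̂)⁻¹Ŝ` (file 23) entries 0∕1 are files 23∕25, entry 2 is file 29;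
entry 3 and the `θ₃` row were open.  They need no Leibniz rule at all: by (3.65) `X = G₀(1 + V̂X̂)` (file 23 `projO_none_dressedV`), so for ANY left factor `T` — second-order `D₃`, the
commutator `[D₃, M_h]`, a covariant derivative outside the jet, the cube's own `[Δ_flat, M_h]` — `T∘X = (T∘G₀)∘(1 + V̂X̂)`: the dressed row is the FLAT row `T∘G₀ ≤ te^{−δd}` times the
Neumann factor, `T∘X ≤ t(1 − βRc_r²)⁻¹e^{−ρ₂d}` (`1 + q(1 − q)⁻¹ = (1 − q)⁻¹`); it is two-sided localized by the flat row's output cut-off `M_χ∘T∘G₀ = T∘G₀` and the flat piece's input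
cut-off `G₀ = G₀M_ψ`; and its η-defect is the exact Leibniz split `𝔇(T′X′, TX) = (T′G₀′)∘(V̂′𝔇(X̂′, X̂) + 𝔇(V̂′, V̂)X̂) + 𝔇(T′G₀′, TG₀)∘(1 + V̂X̂)` over the pair's letters of files 23∕24.

* §1 ★ `comp_projO_none_dressedV` (exact factoring), `comp_dressedV_cutoffs` (both cut-offs of `T∘X`), `idef_id_id` (`𝔇(1, 1) = 0` for equal transports), ★ `idef_comp_dressedV_eq` (exact Leibniz);
* §2 ★★ `hasMaj_comp_dressedV` (`T∘X ≤ t(1 − βRc_r²)⁻¹e^{−ρ₂d}`), ★★ `hasMaj_comp_dressedV_loc₂` (two-sided = FILE 55 `hG3` at `T := D₃`, `hK3′` at `T := [D₃, M_h]`, `hDG` for a left `D` outside the jet);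
* §3 ★★ `hasMaj_idef_comp_dressedV_of` (the η-defect from displayed pair letters `A, A_D`), ★★ `hasMaj_idef_comp_dressedV_loc₂_of` (two-sided = FILE 55 `hIG3`∕`hDK3` shapes).

HONEST FRAMING ∕ LIMITS.  Finite-dimensional resolvent algebra + Neumann∕defect bookkeeping over DISPLAYED flat-cube data (the flat rows `T∘G₀` and their defects for whatever left factors the knit
names, cut-offs, the perturbation's decay letter `R, δ_V` and fit `o`, the pair letters `A, A_D` of files 23∕24); nothing of [B6]∕[B9] asserted ((2.133)–(2.134) p. 247, (3.42) p. 397,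
(3.63)–(3.65) pp. 402–403, Thm 3.14 = SHAPES ∕ MECHANISM ∕ TEMPLATE).  NE2⁺ NOT PRINTED, NOT proved; N15 NOT discharged; counts of record UNMOVED (typed 28∕28 · discharged 5∕27); one finite 𝕋⁴ at
fixed ε — NOT infinite volume, NOT OS on ℝ⁴, NOT a mass gap, NOT Clay; R4 closes the conditional finite-𝕋⁴ rung `BalabanLadder.UV` only.  Restate-immune (no Theses import).
-/

set_option autoImplicit false

noncomputable section
open scoped BigOperators
open Finset

namespace Summit.QuantumFields.YangMills.BalabanUVNodes.N15.CurvedSpecies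

open Literature.MathematicalPhysics.QuantumFieldTheory.Balaban1983to89
open Literature.MathematicalPhysics.QuantumFieldTheory.Balaban1983to89.B11SectG (BlockNorm HasMaj RowSum hasMaj_comp_exp)
open Literature.MathematicalPhysics.QuantumFieldTheory.Balaban1983to89.B6RandomWalk (Triangle254)
open Literature.MathematicalPhysics.QuantumFieldTheory.Balaban1983to89.T4EtaRateDefect (idef idef_apply idef_comp idef_add)
open Literature.MathematicalPhysics.QuantumFieldTheory.Balaban1983to89.T4EtaRateCoeffDefect (pull pull_apply)
open Literature.MathematicalPhysics.QuantumFieldTheory.Balaban1983to89.B6Prop26Gluing (mulOp mulOp_apply ind ind_nonneg)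
open Summit.QuantumFields.YangMills.BalabanUVNodes.N15.MatrixSpecies (liftBlk liftMap)
open Summit.QuantumFields.YangMills.BalabanUVNodes.N15.BackgroundModel (kappa_ofBlocks)
open Summit.QuantumFields.YangMills.BalabanUVNodes.N15.BackgroundLayer (stack projO blkPair liftPair hasMaj_stack hasMaj_projO_comp bgPropV)
open Summit.QuantumFields.YangMills.BalabanUVNodes.N15.Gluing (hasMaj_localize hasMaj_comp_diag hasMaj_diag_comp)

/-! ## §1 Algebra: the resolvent factoring of a left factor, its cut-offs, its exact two-grid Leibniz split -/

section Algebra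

variable {Y K : Type} [Fintype Y] [Fintype K] [DecidableEq Y] [DecidableEq K] {G₀ : (Y → ℝ) →ₗ[ℝ] (Y → ℝ)} {D Dq : K → (Y → ℝ) →ₗ[ℝ] (Y → ℝ)}
  {V : (Y × Option K → ℝ) →ₗ[ℝ] (Y → ℝ)}

/-- ★ **THE RESOLVENT FACTORING OF A LEFT FACTOR**: `T∘X = (T∘G₀)∘(1 + V̂∘X̂)` for every `T` ((3.65)'s `X = G₀(1 + V̂X̂)`, file 23). [cite: Balaban1985BackgroundPropagators, (3.64)–(3.65) pp.402–403 (shape)] -/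
theorem comp_projO_none_dressedV (T : (Y → ℝ) →ₗ[ℝ] (Y → ℝ)) (hunit : IsUnit (1 - LinearMap.toMatrix' (stack G₀ D ∘ₗ V))) :
    T ∘ₗ (projO none ∘ₗ bgPropV (stack G₀ D) V) = (T ∘ₗ G₀) ∘ₗ (LinearMap.id + V ∘ₗ bgPropV (stack G₀ D) V) := by
  rw [projO_none_dressedV hunit, LinearMap.comp_assoc]

/-- BOTH CUT-OFFS OF `T∘X`: output from the flat row's `M_χ∘(T∘G₀) = T∘G₀`, input from the flat piece's `G₀ = G₀M_ψ` (`D_j = Dq_j∘G₀`). [cite: Balaban1984PropagatorsII, (2.133) p.247 (shape)] -/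
theorem comp_dressedV_cutoffs (hDq : ∀ j, D j = Dq j ∘ₗ G₀) (hunit : IsUnit (1 - LinearMap.toMatrix' (stack G₀ D ∘ₗ V))) {T : (Y → ℝ) →ₗ[ℝ] (Y → ℝ)} {χ ψ : Y → ℝ}
    (hTχ : mulOp χ ∘ₗ (T ∘ₗ G₀) = T ∘ₗ G₀) (hGψ : G₀ ∘ₗ mulOp ψ = G₀) :
    mulOp χ ∘ₗ (T ∘ₗ (projO none ∘ₗ bgPropV (stack G₀ D) V)) = T ∘ₗ (projO none ∘ₗ bgPropV (stack G₀ D) V) ∧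
      (T ∘ₗ (projO none ∘ₗ bgPropV (stack G₀ D) V)) ∘ₗ mulOp ψ = T ∘ₗ (projO none ∘ₗ bgPropV (stack G₀ D) V) := by
  refine ⟨?_, ?_⟩
  · rw [comp_projO_none_dressedV T hunit, ← LinearMap.comp_assoc, hTχ]
  · rw [LinearMap.comp_assoc, LinearMap.comp_assoc, dressedV_comp_eq_self (V := V) hDq hGψ]

end Algebra

section Leibniz

variable {X X' ι J : Type} [Fintype X] [Fintype X'] [DecidableEq X] [DecidableEq X'] [Fintype ι] [DecidableEq ι] [Fintype J] [DecidableEq J] (π : X' → X)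
  {G₀ : (X × ι → ℝ) →ₗ[ℝ] (X × ι → ℝ)} {D : J ⊕ J → (X × ι → ℝ) →ₗ[ℝ] (X × ι → ℝ)} {V : ((X × ι) × Option (J ⊕ J) → ℝ) →ₗ[ℝ] (X × ι → ℝ)}
  {G₀' : (X' × ι → ℝ) →ₗ[ℝ] (X' × ι → ℝ)} {D' : J ⊕ J → (X' × ι → ℝ) →ₗ[ℝ] (X' × ι → ℝ)} {V' : ((X' × ι) × Option (J ⊕ J) → ℝ) →ₗ[ℝ] (X' × ι → ℝ)}

omit [Fintype X] [Fintype X'] [DecidableEq X] [DecidableEq X'] [Fintype ι] [DecidableEq ι] [Fintype J] [DecidableEq J] in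
/-- `𝔇(1, 1) = 0` when input and output transports agree. [folklore] -/
theorem idef_id_id : idef (pull (liftMap π ι)) (pull (liftMap π ι)) (LinearMap.id : (X' × ι → ℝ) →ₗ[ℝ] (X' × ι → ℝ)) (LinearMap.id : (X × ι → ℝ) →ₗ[ℝ] (X × ι → ℝ)) = 0 := by
  refine LinearMap.ext fun v => funext fun p' => ?_
  simp only [idef_apply, LinearMap.id_apply, Pi.sub_apply, pull_apply, sub_self, LinearMap.zero_apply, Pi.zero_apply]

/-- ★ **THE EXACT TWO-GRID LEIBNIZ SPLIT OF A LEFT FACTOR's ROW**: `𝔇(T′X′, TX) = (T′G₀′)∘(V̂′∘𝔇(X̂′, X̂) + 𝔇(V̂′, V̂)∘X̂) + 𝔇(T′G₀′, TG₀)∘(1 + V̂∘X̂)`. [cite: Balaban1985BackgroundPropagators, Thm 3.14 pp.426–427 (difference template)] -/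
theorem idef_comp_dressedV_eq (T : (X × ι → ℝ) →ₗ[ℝ] (X × ι → ℝ)) (T' : (X' × ι → ℝ) →ₗ[ℝ] (X' × ι → ℝ)) (hunit : IsUnit (1 - LinearMap.toMatrix' (stack G₀ D ∘ₗ V)))
    (hunit' : IsUnit (1 - LinearMap.toMatrix' (stack G₀' D' ∘ₗ V'))) :
    idef (pull (liftMap π ι)) (pull (liftMap π ι)) (T' ∘ₗ (projO none ∘ₗ bgPropV (stack G₀' D') V')) (T ∘ₗ (projO none ∘ₗ bgPropV (stack G₀ D) V)) =
      (T' ∘ₗ G₀') ∘ₗ (V' ∘ₗ idef (pull (liftMap π ι)) (pull (liftPair (liftMap π ι))) (bgPropV (stack G₀' D') V') (bgPropV (stack G₀ D) V) +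
          idef (pull (liftPair (liftMap π ι))) (pull (liftMap π ι)) V' V ∘ₗ bgPropV (stack G₀ D) V) +
        idef (pull (liftMap π ι)) (pull (liftMap π ι)) (T' ∘ₗ G₀') (T ∘ₗ G₀) ∘ₗ (LinearMap.id + V ∘ₗ bgPropV (stack G₀ D) V) := by
  rw [comp_projO_none_dressedV T hunit, comp_projO_none_dressedV T' hunit',
    idef_comp (pull (liftMap π ι)) (pull (liftMap π ι)) (pull (liftMap π ι)) (T' ∘ₗ G₀') (LinearMap.id + V' ∘ₗ bgPropV (stack G₀' D') V') (T ∘ₗ G₀)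
      (LinearMap.id + V ∘ₗ bgPropV (stack G₀ D) V),
    idef_add, idef_id_id, zero_add, idef_comp (pull (liftMap π ι)) (pull (liftPair (liftMap π ι))) (pull (liftMap π ι)) V' (bgPropV (stack G₀' D') V') V (bgPropV (stack G₀ D) V)]

end Leibniz

/-! ## §2 The letter of a left factor through the dressing, and its two-sided localization -/

section Rows

variable {X ι J : Type} [Fintype X] [DecidableEq X] [Fintype ι] [DecidableEq ι] [Fintype J] [DecidableEq J] {g : B6.Geometry} (blk : X → g.Site) {σ cr : ℝ}
  {G₀ : (X × ι → ℝ) →ₗ[ℝ] (X × ι → ℝ)} {D Dq : J ⊕ J → (X × ι → ℝ) →ₗ[ℝ] (X × ι → ℝ)} {V : ((X × ι) × Option (J ⊕ J) → ℝ) →ₗ[ℝ] (X × ι → ℝ)}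

/-- `1 + q(1 − q)⁻¹ = (1 − q)⁻¹` in the form the Neumann factor appears: `t + t·(R·(β(1 − q)⁻¹)·c_r)·c_r = t(1 − q)⁻¹`, `q = βRc_r²`, `q < 1`. [folklore] -/
theorem neumannFactor_eq {t β R cr : ℝ} (hq : β * (R * cr) * cr < 1) :
    t + t * (R * (β * (1 - β * (R * cr) * cr)⁻¹) * cr) * cr = t * (1 - β * (R * cr) * cr)⁻¹ := by
  have hq' : (1 - β * (R * cr) * cr) ≠ 0 := ne_of_gt (by linarith)
  have hX : (1 - β * (R * cr) * cr) * (1 - β * (R * cr) * cr)⁻¹ = 1 := mul_inv_cancel₀ hq'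
  calc t + t * (R * (β * (1 - β * (R * cr) * cr)⁻¹) * cr) * cr
      = t * ((1 - β * (R * cr) * cr) * (1 - β * (R * cr) * cr)⁻¹) + t * (R * (β * (1 - β * (R * cr) * cr)⁻¹) * cr) * cr := by rw [hX, mul_one]
    _ = t * (1 - β * (R * cr) * cr)⁻¹ := by ring

/-- ★★ **A LEFT FACTOR THROUGH THE DRESSING**: the flat row `T∘G₀ ≤ te^{−δd}` and file 23's pair data (`G₀, D_j ≤ βe^{−δd}`, `V̂ ≤ Re^{−δ_Vd}`, rates `σ ≤ ρ₁ ≤ δ_V`, `ρ₁ + σ ≤ δ`, `ρ₂ + σ ≤ ρ₁`,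
`βRc_r² < 1`) ⟹ `T∘X ≤ t(1 − βRc_r²)⁻¹e^{−ρ₂d}` — entry 3 (`T := D₃`), the `θ₃` row (`T := [D₃, M_h]`), any left `D` outside the jet.
[cite: Balaban1985BackgroundPropagators, (3.42) p.397 (entries: shape), (3.63)–(3.65) pp.402–403 (mechanism); Balaban1984PropagatorsII, (2.134) p.247 (shape)] -/
theorem hasMaj_comp_dressedV (htri : Triangle254 g) (hd : ∀ a b : g.Site, 0 ≤ g.dist a b) (hrow : RowSum g σ cr) (hσ : 0 ≤ σ) {ρ₁ ρ₂ δ δV β R t : ℝ} (hβ : 0 ≤ β) (hR : 0 ≤ R)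
    (ht : 0 ≤ t) (hcr : 0 ≤ cr) (hσρ : σ ≤ ρ₁) (hρ₁V : ρ₁ ≤ δV) (hρ₁G : ρ₁ + σ ≤ δ) (hρ₂ : 0 ≤ ρ₂) (hρ₂₁ : ρ₂ + σ ≤ ρ₁) (T : (X × ι → ℝ) →ₗ[ℝ] (X × ι → ℝ))
    (hG : HasMaj (BlockNorm.ofBlocks g (liftBlk blk ι)) (BlockNorm.ofBlocks g (liftBlk blk ι)) G₀ (fun y y' => β * Real.exp (-(δ * g.dist y y'))))
    (hD : ∀ j, HasMaj (BlockNorm.ofBlocks g (liftBlk blk ι)) (BlockNorm.ofBlocks g (liftBlk blk ι)) (D j) (fun y y' => β * Real.exp (-(δ * g.dist y y'))))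
    (hV : HasMaj (BlockNorm.ofBlocks g (blkPair (liftBlk blk ι))) (BlockNorm.ofBlocks g (liftBlk blk ι)) V (fun y y' => R * Real.exp (-(δV * g.dist y y'))))
    (hq : β * (R * cr) * cr < 1)
    (hTG : HasMaj (BlockNorm.ofBlocks g (liftBlk blk ι)) (BlockNorm.ofBlocks g (liftBlk blk ι)) (T ∘ₗ G₀) (fun y y' => t * Real.exp (-(δ * g.dist y y')))) :
    HasMaj (BlockNorm.ofBlocks g (liftBlk blk ι)) (BlockNorm.ofBlocks g (liftBlk blk ι)) (T ∘ₗ (projO none ∘ₗ bgPropV (stack G₀ D) V))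
      (fun y y' => t * (1 - β * (R * cr) * cr)⁻¹ * Real.exp (-(ρ₂ * g.dist y y'))) := by
  obtain ⟨hunit, -⟩ := hasMaj_dressedV_pair blk htri hd hrow hσ hβ hR hcr hσρ hρ₁V hρ₁G hρ₂ hρ₂₁ hG hD hV hq
  have hS := hasMaj_stack (liftBlk blk ι) (fun _ _ => mul_nonneg hβ (Real.exp_nonneg _)) hG hD
  have hVX := hasMaj_V_bgPropVE (liftBlk blk ι) (blkPair (liftBlk blk ι)) htri hd hrow hσ hβ hR hcr hσρ hρ₁V hρ₁G hρ₂ hρ₂₁ hS hV hq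
  have hβX : 0 ≤ R * (β * (1 - β * (R * cr) * cr)⁻¹) * cr := mul_nonneg (mul_nonneg hR (mul_nonneg hβ (inv_nonneg.2 (by linarith)))) hcr
  have hρ₂δ : ρ₂ + σ ≤ δ := by linarith
  have t2 := hasMaj_comp_exp htri hd hrow ht hβX hρ₂ le_rfl hρ₂δ hTG hVX
  have t1 : HasMaj (BlockNorm.ofBlocks g (liftBlk blk ι)) (BlockNorm.ofBlocks g (liftBlk blk ι)) (T ∘ₗ G₀) (fun y y' => t * Real.exp (-(ρ₂ * g.dist y y'))) :=
    hTG.mono fun a b => mul_le_mul_of_nonneg_left (Real.exp_le_exp.mpr (by nlinarith [hd a b])) ht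
  rw [comp_projO_none_dressedV T hunit, LinearMap.comp_add, LinearMap.comp_id]
  refine (t1.add t2).mono fun y y' => le_of_eq ?_
  rw [kappa_ofBlocks, ← neumannFactor_eq (t := t) hq]
  ring

/-- ★★ **… TWO-SIDED LOCALIZED** (FILE 55's `hG3` at `T := D₃`, `hK3′`∕`θ₃` at `T := [D₃, M_h]` from the FLAT cube's rows `D₃∘G₀`, `[D₃, M_h]∘G₀`): the flat row's output cut-off `M_χ∘(T∘G₀) = T∘G₀`
(`supp χ` over `S`) and the flat piece's input cut-off `G₀ = G₀M_ψ` (`supp ψ` over `S`, `D_j = Dq_j∘G₀`) ⟹ `T∘X ≤ 1_S(y)1_S(y′)·t(1 − βRc_r²)⁻¹e^{−ρ₂d}`.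
[cite: Balaban1984PropagatorsII, (2.133)–(2.134) p.247 (shapes); Balaban1985BackgroundPropagators, (3.65) p.403 (mechanism)] -/
theorem hasMaj_comp_dressedV_loc₂ (htri : Triangle254 g) (hd : ∀ a b : g.Site, 0 ≤ g.dist a b) (hrow : RowSum g σ cr) (hσ : 0 ≤ σ) {ρ₁ ρ₂ δ δV β R t : ℝ} (hβ : 0 ≤ β)
    (hR : 0 ≤ R) (ht : 0 ≤ t) (hcr : 0 ≤ cr) (hσρ : σ ≤ ρ₁) (hρ₁V : ρ₁ ≤ δV) (hρ₁G : ρ₁ + σ ≤ δ) (hρ₂ : 0 ≤ ρ₂) (hρ₂₁ : ρ₂ + σ ≤ ρ₁) (hDq : ∀ j, D j = Dq j ∘ₗ G₀)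
    (T : (X × ι → ℝ) →ₗ[ℝ] (X × ι → ℝ)) {S : Set g.Site} {χX ψX : X → ℝ} (hSχ : ∀ x, χX x ≠ 0 → blk x ∈ S) (hSψ : ∀ x, ψX x ≠ 0 → blk x ∈ S)
    (hTχ : mulOp (fun p : X × ι => χX p.1) ∘ₗ (T ∘ₗ G₀) = T ∘ₗ G₀) (hGψ : G₀ ∘ₗ mulOp (fun p : X × ι => ψX p.1) = G₀)
    (hG : HasMaj (BlockNorm.ofBlocks g (liftBlk blk ι)) (BlockNorm.ofBlocks g (liftBlk blk ι)) G₀ (fun y y' => β * Real.exp (-(δ * g.dist y y'))))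
    (hD : ∀ j, HasMaj (BlockNorm.ofBlocks g (liftBlk blk ι)) (BlockNorm.ofBlocks g (liftBlk blk ι)) (D j) (fun y y' => β * Real.exp (-(δ * g.dist y y'))))
    (hV : HasMaj (BlockNorm.ofBlocks g (blkPair (liftBlk blk ι))) (BlockNorm.ofBlocks g (liftBlk blk ι)) V (fun y y' => R * Real.exp (-(δV * g.dist y y'))))
    (hq : β * (R * cr) * cr < 1)
    (hTG : HasMaj (BlockNorm.ofBlocks g (liftBlk blk ι)) (BlockNorm.ofBlocks g (liftBlk blk ι)) (T ∘ₗ G₀) (fun y y' => t * Real.exp (-(δ * g.dist y y')))) :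
    HasMaj (BlockNorm.ofBlocks g (liftBlk blk ι)) (BlockNorm.ofBlocks g (liftBlk blk ι)) (T ∘ₗ (projO none ∘ₗ bgPropV (stack G₀ D) V))
      (fun y y' => ind S y * ind S y' * (t * (1 - β * (R * cr) * cr)⁻¹ * Real.exp (-(ρ₂ * g.dist y y')))) := by
  obtain ⟨hunit, -⟩ := hasMaj_dressedV_pair blk htri hd hrow hσ hβ hR hcr hσρ hρ₁V hρ₁G hρ₂ hρ₂₁ hG hD hV hq
  have key := hasMaj_comp_dressedV blk htri hd hrow hσ hβ hR ht hcr hσρ hρ₁V hρ₁G hρ₂ hρ₂₁ T hG hD hV hq hTG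
  have htX : 0 ≤ t * (1 - β * (R * cr) * cr)⁻¹ := mul_nonneg ht (inv_nonneg.2 (by linarith))
  obtain ⟨hout, hin⟩ := comp_dressedV_cutoffs (V := V) hDq hunit hTχ hGψ
  refine hasMaj_localize (liftBlk blk ι) (liftBlk blk ι) (fun a b => mul_nonneg htX (Real.exp_nonneg _)) (fun μ p hp => ?_) (fun μ hμ => ?_) key
  · have hχ0 : χX p.1 = 0 := by by_contra h; exact hp (hSχ p.1 h)
    rw [← hout]
    simp only [LinearMap.comp_apply, mulOp_apply, hχ0, zero_mul]
  · rw [← hin, LinearMap.comp_apply, mulOp_eq_zero_of_vanish blk hSψ μ hμ, map_zero]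

end Rows

/-! ## §3 The η-defect of a left factor through the dressing -/

section Defects

variable {X X' ι J : Type} [Fintype X] [Fintype X'] [DecidableEq X] [DecidableEq X'] [Fintype ι] [DecidableEq ι] [Fintype J] [DecidableEq J] {g : B6.Geometry}
  (blk : X → g.Site) (π : X' → X) {σ cr : ℝ} {G₀ : (X × ι → ℝ) →ₗ[ℝ] (X × ι → ℝ)} {D Dq : J ⊕ J → (X × ι → ℝ) →ₗ[ℝ] (X × ι → ℝ)}
  {V : ((X × ι) × Option (J ⊕ J) → ℝ) →ₗ[ℝ] (X × ι → ℝ)} {G₀' : (X' × ι → ℝ) →ₗ[ℝ] (X' × ι → ℝ)} {D' Dq' : J ⊕ J → (X' × ι → ℝ) →ₗ[ℝ] (X' × ι → ℝ)}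
  {V' : ((X' × ι) × Option (J ⊕ J) → ℝ) →ₗ[ℝ] (X' × ι → ℝ)}

/-- ★★ **THE η-DEFECT OF A LEFT FACTOR THROUGH THE DRESSING** (pair letters displayed, as in file 28): the units at both grids, the fine flat row `T′∘G₀′ ≤ te^{−δd}`, the flat row's defect
`𝔇(T′G₀′, TG₀) ≤ m_Te^{−δd}`, the pair `X̂ ≤ Ae^{−ρ₂d}` and its defect `𝔇(X̂′, X̂) ≤ A_De^{−ρ₂d}` (files 23∕24), `V̂, V̂′ ≤ Re^{−δ_Vd}`, `𝔇(V̂′, V̂) ≤ oe^{−δ_Vd}`, rates `σ ≤ ρ₂`, `ρ₂ + σ ≤ δ_V`, `ρ₂ + σ ≤ δ` ⟹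
`𝔇(T′X′, TX) ≤ (t(RA_D + oA)c_r² + m_T(1 + RAc_r²))·e^{−ρ₂d}`. [cite: Balaban1985BackgroundPropagators, Thm 3.14 pp.426–427 (difference template); Balaban1984PropagatorsII, (2.52)–(2.56) pp.232–233] -/
theorem hasMaj_idef_comp_dressedV_of (htri : Triangle254 g) (hd : ∀ a b : g.Site, 0 ≤ g.dist a b) (hrow : RowSum g σ cr) (hσ : 0 ≤ σ) (hcr : 0 ≤ cr) {ρ₂ δ δV R o t mT A AD : ℝ}
    (hR : 0 ≤ R) (ho : 0 ≤ o) (ht : 0 ≤ t) (hmT : 0 ≤ mT) (hA : 0 ≤ A) (hAD : 0 ≤ AD) (hσρ : σ ≤ ρ₂) (hρ₂V : ρ₂ + σ ≤ δV) (hρ₂δ : ρ₂ + σ ≤ δ)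
    (T : (X × ι → ℝ) →ₗ[ℝ] (X × ι → ℝ)) (T' : (X' × ι → ℝ) →ₗ[ℝ] (X' × ι → ℝ)) (hunit : IsUnit (1 - LinearMap.toMatrix' (stack G₀ D ∘ₗ V)))
    (hunit' : IsUnit (1 - LinearMap.toMatrix' (stack G₀' D' ∘ₗ V')))
    (hTG' : HasMaj (BlockNorm.ofBlocks g (liftBlk (blk ∘ π) ι)) (BlockNorm.ofBlocks g (liftBlk (blk ∘ π) ι)) (T' ∘ₗ G₀') (fun y y' => t * Real.exp (-(δ * g.dist y y'))))
    (hDTG : HasMaj (BlockNorm.ofBlocks g (liftBlk blk ι)) (BlockNorm.ofBlocks g (liftBlk (blk ∘ π) ι)) (idef (pull (liftMap π ι)) (pull (liftMap π ι)) (T' ∘ₗ G₀') (T ∘ₗ G₀))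
      (fun y y' => mT * Real.exp (-(δ * g.dist y y'))))
    (hX : HasMaj (BlockNorm.ofBlocks g (liftBlk blk ι)) (BlockNorm.ofBlocks g (blkPair (liftBlk blk ι))) (bgPropV (stack G₀ D) V) (fun y y' => A * Real.exp (-(ρ₂ * g.dist y y'))))
    (hDX : HasMaj (BlockNorm.ofBlocks g (liftBlk blk ι)) (BlockNorm.ofBlocks g (blkPair (liftBlk (blk ∘ π) ι)))
      (idef (pull (liftMap π ι)) (pull (liftPair (liftMap π ι))) (bgPropV (stack G₀' D') V') (bgPropV (stack G₀ D) V)) (fun y y' => AD * Real.exp (-(ρ₂ * g.dist y y'))))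
    (hV : HasMaj (BlockNorm.ofBlocks g (blkPair (liftBlk blk ι))) (BlockNorm.ofBlocks g (liftBlk blk ι)) V (fun y y' => R * Real.exp (-(δV * g.dist y y'))))
    (hV' : HasMaj (BlockNorm.ofBlocks g (blkPair (liftBlk (blk ∘ π) ι))) (BlockNorm.ofBlocks g (liftBlk (blk ∘ π) ι)) V' (fun y y' => R * Real.exp (-(δV * g.dist y y'))))
    (hDV : HasMaj (BlockNorm.ofBlocks g (blkPair (liftBlk blk ι))) (BlockNorm.ofBlocks g (liftBlk (blk ∘ π) ι))
      (idef (pull (liftPair (liftMap π ι))) (pull (liftMap π ι)) V' V) (fun y y' => o * Real.exp (-(δV * g.dist y y')))) :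
    HasMaj (BlockNorm.ofBlocks g (liftBlk blk ι)) (BlockNorm.ofBlocks g (liftBlk (blk ∘ π) ι))
      (idef (pull (liftMap π ι)) (pull (liftMap π ι)) (T' ∘ₗ (projO none ∘ₗ bgPropV (stack G₀' D') V')) (T ∘ₗ (projO none ∘ₗ bgPropV (stack G₀ D) V)))
      (fun y y' => (t * (R * AD + o * A) * cr * cr + mT * (1 + R * A * cr * cr)) * Real.exp (-(ρ₂ * g.dist y y'))) := by
  have hρ₂ : 0 ≤ ρ₂ := hσ.trans hσρ
  -- `V̂′∘𝔇(X̂′,X̂) + 𝔇(V̂′,V̂)∘X̂ ≤ (RA_D + oA)c_r·e^{−ρ₂d}`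
  have u1 := hasMaj_comp_exp htri hd hrow hR hAD hρ₂ le_rfl hρ₂V hV' hDX
  have u2 := hasMaj_comp_exp htri hd hrow ho hA hρ₂ le_rfl hρ₂V hDV hX
  have hin : HasMaj (BlockNorm.ofBlocks g (liftBlk blk ι)) (BlockNorm.ofBlocks g (liftBlk (blk ∘ π) ι))
      (V' ∘ₗ idef (pull (liftMap π ι)) (pull (liftPair (liftMap π ι))) (bgPropV (stack G₀' D') V') (bgPropV (stack G₀ D) V) +
        idef (pull (liftPair (liftMap π ι))) (pull (liftMap π ι)) V' V ∘ₗ bgPropV (stack G₀ D) V)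
      (fun y y' => (R * AD + o * A) * cr * Real.exp (-(ρ₂ * g.dist y y'))) := by
    refine (u1.add u2).mono fun y y' => le_of_eq ?_
    simp only [kappa_ofBlocks]
    ring
  have p1 := hasMaj_comp_exp htri hd hrow ht (by positivity : 0 ≤ (R * AD + o * A) * cr) hρ₂ le_rfl hρ₂δ hTG' hin
  -- `𝔇(T′G₀′, TG₀)∘(1 + V̂X̂) ≤ m_T(1 + RAc_r²)e^{−ρ₂d}`
  have hVX : HasMaj (BlockNorm.ofBlocks g (liftBlk blk ι)) (BlockNorm.ofBlocks g (liftBlk blk ι)) (V ∘ₗ bgPropV (stack G₀ D) V)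
      (fun y y' => R * A * cr * Real.exp (-(ρ₂ * g.dist y y'))) := by
    refine (hasMaj_comp_exp htri hd hrow hR hA hρ₂ le_rfl hρ₂V hV hX).mono fun y y' => le_of_eq ?_
    rw [kappa_ofBlocks]; ring
  have p2 := hasMaj_comp_exp htri hd hrow hmT (by positivity : 0 ≤ R * A * cr) hρ₂ le_rfl hρ₂δ hDTG hVX
  have p3 : HasMaj (BlockNorm.ofBlocks g (liftBlk blk ι)) (BlockNorm.ofBlocks g (liftBlk (blk ∘ π) ι)) (idef (pull (liftMap π ι)) (pull (liftMap π ι)) (T' ∘ₗ G₀') (T ∘ₗ G₀))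
      (fun y y' => mT * Real.exp (-(ρ₂ * g.dist y y'))) :=
    hDTG.mono fun a b => mul_le_mul_of_nonneg_left (Real.exp_le_exp.mpr (by nlinarith [hd a b])) hmT
  have p23 : HasMaj (BlockNorm.ofBlocks g (liftBlk blk ι)) (BlockNorm.ofBlocks g (liftBlk (blk ∘ π) ι))
      (idef (pull (liftMap π ι)) (pull (liftMap π ι)) (T' ∘ₗ G₀') (T ∘ₗ G₀) ∘ₗ (LinearMap.id + V ∘ₗ bgPropV (stack G₀ D) V))
      (fun y y' => mT * (1 + R * A * cr * cr) * Real.exp (-(ρ₂ * g.dist y y'))) := by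
    rw [LinearMap.comp_add, LinearMap.comp_id]
    refine (p3.add p2).mono fun y y' => le_of_eq ?_
    rw [kappa_ofBlocks]; ring
  rw [idef_comp_dressedV_eq π T T' hunit hunit']
  refine (p1.add p23).mono fun y y' => le_of_eq ?_
  rw [kappa_ofBlocks]; ring

/-- ★★ **… TWO-SIDED LOCALIZED** (FILE 55's `hIG3` at `T := D₃`, `hDK3` at `T := [D₃, M_h]` on the general dressed cube): the cut-offs `M_χ∘(T∘G₀) = T∘G₀`, `G₀ = G₀M_ψ` at BOTH grids (over `S`
through `blk`, `blk∘π`) and `D = Dq∘G₀`, `D′ = Dq′∘G₀′` ⟹ the letter of `hasMaj_idef_comp_dressedV_of` carries `1_S(y)1_S(y′)`. [cite: Balaban1984PropagatorsII, (2.133) p.247 (shape); Balaban1985BackgroundPropagators, Thm 3.14 pp.426–427 (template)] -/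
theorem hasMaj_idef_comp_dressedV_loc₂_of (htri : Triangle254 g) (hd : ∀ a b : g.Site, 0 ≤ g.dist a b) (hrow : RowSum g σ cr) (hσ : 0 ≤ σ) (hcr : 0 ≤ cr)
    {ρ₂ δ δV R o t mT A AD : ℝ} (hR : 0 ≤ R) (ho : 0 ≤ o) (ht : 0 ≤ t) (hmT : 0 ≤ mT) (hA : 0 ≤ A) (hAD : 0 ≤ AD) (hσρ : σ ≤ ρ₂) (hρ₂V : ρ₂ + σ ≤ δV) (hρ₂δ : ρ₂ + σ ≤ δ)
    (T : (X × ι → ℝ) →ₗ[ℝ] (X × ι → ℝ)) (T' : (X' × ι → ℝ) →ₗ[ℝ] (X' × ι → ℝ)) (hDq : ∀ j, D j = Dq j ∘ₗ G₀) (hDq' : ∀ j, D' j = Dq' j ∘ₗ G₀')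
    (hunit : IsUnit (1 - LinearMap.toMatrix' (stack G₀ D ∘ₗ V))) (hunit' : IsUnit (1 - LinearMap.toMatrix' (stack G₀' D' ∘ₗ V'))) {S : Set g.Site} {χX ψX : X → ℝ} {χX' ψX' : X' → ℝ}
    (hSχ : ∀ x, χX x ≠ 0 → blk x ∈ S) (hSψ : ∀ x, ψX x ≠ 0 → blk x ∈ S) (hSχ' : ∀ x', χX' x' ≠ 0 → blk (π x') ∈ S) (hSψ' : ∀ x', ψX' x' ≠ 0 → blk (π x') ∈ S)
    (hTχ : mulOp (fun p : X × ι => χX p.1) ∘ₗ (T ∘ₗ G₀) = T ∘ₗ G₀) (hGψ : G₀ ∘ₗ mulOp (fun p : X × ι => ψX p.1) = G₀)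
    (hTχ' : mulOp (fun p : X' × ι => χX' p.1) ∘ₗ (T' ∘ₗ G₀') = T' ∘ₗ G₀') (hGψ' : G₀' ∘ₗ mulOp (fun p : X' × ι => ψX' p.1) = G₀')
    (hTG' : HasMaj (BlockNorm.ofBlocks g (liftBlk (blk ∘ π) ι)) (BlockNorm.ofBlocks g (liftBlk (blk ∘ π) ι)) (T' ∘ₗ G₀') (fun y y' => t * Real.exp (-(δ * g.dist y y'))))
    (hDTG : HasMaj (BlockNorm.ofBlocks g (liftBlk blk ι)) (BlockNorm.ofBlocks g (liftBlk (blk ∘ π) ι)) (idef (pull (liftMap π ι)) (pull (liftMap π ι)) (T' ∘ₗ G₀') (T ∘ₗ G₀))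
      (fun y y' => mT * Real.exp (-(δ * g.dist y y'))))
    (hX : HasMaj (BlockNorm.ofBlocks g (liftBlk blk ι)) (BlockNorm.ofBlocks g (blkPair (liftBlk blk ι))) (bgPropV (stack G₀ D) V) (fun y y' => A * Real.exp (-(ρ₂ * g.dist y y'))))
    (hDX : HasMaj (BlockNorm.ofBlocks g (liftBlk blk ι)) (BlockNorm.ofBlocks g (blkPair (liftBlk (blk ∘ π) ι)))
      (idef (pull (liftMap π ι)) (pull (liftPair (liftMap π ι))) (bgPropV (stack G₀' D') V') (bgPropV (stack G₀ D) V)) (fun y y' => AD * Real.exp (-(ρ₂ * g.dist y y'))))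
    (hV : HasMaj (BlockNorm.ofBlocks g (blkPair (liftBlk blk ι))) (BlockNorm.ofBlocks g (liftBlk blk ι)) V (fun y y' => R * Real.exp (-(δV * g.dist y y'))))
    (hV' : HasMaj (BlockNorm.ofBlocks g (blkPair (liftBlk (blk ∘ π) ι))) (BlockNorm.ofBlocks g (liftBlk (blk ∘ π) ι)) V' (fun y y' => R * Real.exp (-(δV * g.dist y y'))))
    (hDV : HasMaj (BlockNorm.ofBlocks g (blkPair (liftBlk blk ι))) (BlockNorm.ofBlocks g (liftBlk (blk ∘ π) ι))
      (idef (pull (liftPair (liftMap π ι))) (pull (liftMap π ι)) V' V) (fun y y' => o * Real.exp (-(δV * g.dist y y')))) :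
    HasMaj (BlockNorm.ofBlocks g (liftBlk blk ι)) (BlockNorm.ofBlocks g (liftBlk (blk ∘ π) ι))
      (idef (pull (liftMap π ι)) (pull (liftMap π ι)) (T' ∘ₗ (projO none ∘ₗ bgPropV (stack G₀' D') V')) (T ∘ₗ (projO none ∘ₗ bgPropV (stack G₀ D) V)))
      (fun y y' => ind S y * ind S y' * ((t * (R * AD + o * A) * cr * cr + mT * (1 + R * A * cr * cr)) * Real.exp (-(ρ₂ * g.dist y y')))) := by
  have key := hasMaj_idef_comp_dressedV_of blk π htri hd hrow hσ hcr hR ho ht hmT hA hAD hσρ hρ₂V hρ₂δ T T' hunit hunit' hTG' hDTG hX hDX hV hV' hDV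
  have hK0 : ∀ a b : g.Site, 0 ≤ (t * (R * AD + o * A) * cr * cr + mT * (1 + R * A * cr * cr)) * Real.exp (-(ρ₂ * g.dist a b)) := fun a b => by positivity
  obtain ⟨houtc, hinc⟩ := comp_dressedV_cutoffs (V := V) hDq hunit hTχ hGψ
  obtain ⟨houtf, hinf⟩ := comp_dressedV_cutoffs (V := V') hDq' hunit' hTχ' hGψ'
  obtain ⟨hout, hin⟩ := idef_out_in blk π hSχ hSψ hSχ' hSψ' houtc hinc houtf hinf
  exact hasMaj_localize (liftBlk blk ι) (liftBlk (blk ∘ π) ι) hK0 hout hin key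

end Defects

end Summit.QuantumFields.YangMills.BalabanUVNodes.N15.CurvedSpecies

end
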